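import Summits.CriticalPhenomena.PercolationContinuityZ3.Theorems.PercNearOneGluingNoHeavyConstsClusterSquareApicesQuadTwoPair
import HarnessLib

/-!
# Outerplanar graph plus independent apices: a bad APEX ROOT separates its two terminals (failure of the sector condition)

builds on p205010 (kernel theorem, internal audit signed; external expert review pending)

PAPER-2 track "percolation constants", part (ii), seat `prim-consts-1`, gen 22 (lane index
`run/shared/lean/prim/consts/CONSTANTS.md`, row A19; memo `FROM-prim-consts-1-g22-CROSS-LINKAGE.md` §2).
Support file for the crux `NoHeavyLowerTail` (stmt-CriticalPhenomena-4575; `--supports`).  Theorems only; no definitions, no sorries.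

SETTING (class (I)(R)(F)(L)(L2) of `…ConstsClusterSquareApices.lean`, abstract graphs of `…ConstsClusterSquareApicesGap.lean`).  By
`…ConstsClusterSquareApicesQuad.lean` no quadruple clash occurs at a RIM root.  At an APEX root `h` a quadruple clash lives on the
cluster `K = {h}` (any larger cluster contains a rim vertex): four rim neighbours `y, z, y', z'` of `h` and walks `y → z ∋ b`,
`y' → z' ∋ c` (disjoint) and `y' → z ∋ b`, `y → z' ∋ c` (disjoint) in `H − h` ("bad root data").  A terminal `x` is REPRESENTED by
itself if it is a rim vertex and by its rim neighbours if it is an apex (`Consts.Apices.exists_reps'`).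
`Consts.Apices.sep_of_badRoot` (cut open at `y`): bad root data at `(h; b, c)` yield a representative `t` of `b` and a representative
`t'` of `c` STRICTLY SEPARATED by the chord `{y, y'}` of `h` — the SECTOR CONDITION "no chord of `h` separates a representative of `b`
from a representative of `c`" fails.  Proof: the gap lemma (`Consts.Apices.gap_of_root`) for `{h} ∪ supp(y → z)` against `y' → z'` and
for `{h} ∪ supp(y → z')` against `y' → z` gives the orientation `z < y' < z'` (or its mirror, handled by the symmetry `z ↔ z'`, `b ↔ c`)
and four interval facts; (L)/(F) at the chords of `b`, `c`, `h` then pin a representative of `b` inside `(y, y')` and one of `c` beyond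
`y'` (`Consts.Apices.sep_core`).  This generalises the sector condition (S) of `…ConstsClusterSquareApexHub.lean` (one apex, rim terminals)
to any number of apices and arbitrary terminals; used by `…ConstsClusterSquareApicesApexRoot.lean`.
Census (lane engines g22 `eng/apexroot3.py`, `eng/t1_check.py`): three apices, ≤ 5 rim vertices (19 840 / 390 144 graphs): 42 / 1 915
bad apex roots, every one of them separating its terminals (0 exceptions).
References: N. Gladkov, arXiv:2408.08457v2 (2024), Def. 4.2, Thm. 4.3; G. Chartrand, F. Harary, Ann. Inst. H. Poincaré B 3 (1967)
433–438 (outerplanar graphs).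
-/

noncomputable section

open Classical

namespace Summit.CriticalPhenomena.PercolationContinuityZ3.Theorems

open MeasureTheory Finset Literature.Probability.LatticeModels Literature.Probability.Percolation

namespace Consts

namespace Apices

variable {n m : ℕ} {pos : Fin n → Fin m} {hub : Fin n → Prop}

/-! ### Representatives and connectivity helpers -/

/-- Representatives of a vertex `v` on two walks leaving it: `v` itself if `v` is a rim vertex, else the second vertices (rim
neighbours, hubs being pairwise non-adjacent); the walks need to be non-trivial only when `v` is a hub. [folklore] -/
theorem exists_reps' {H : SimpleGraph (Fin n)} (hI : ∀ u v, hub u → hub v → ¬ H.Adj u v) {v t t' : Fin n}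
    (R : H.Walk v t) (R' : H.Walk v t') (hvt : hub v → v ≠ t) (hvt' : hub v → v ≠ t') :
    ∃ p q, ¬ hub p ∧ p ∈ R.support ∧ ¬ hub q ∧ q ∈ R'.support ∧
      ((¬ hub v ∧ p = v ∧ q = v) ∨ (hub v ∧ H.Adj v p ∧ H.Adj v q)) := by
  by_cases hv : hub v
  · cases R with
    | nil => exact absurd rfl (hvt hv)
    | @cons _ p _ hp T =>
      cases R' with
      | nil => exact absurd rfl (hvt' hv)
      | @cons _ q _ hq T' =>
        exact ⟨p, q, fun h => hI v p hv h hp, by simp, fun h => hI v q hv h hq, by simp, Or.inr ⟨hv, hp, hq⟩⟩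
  · exact ⟨v, v, hv, R.start_mem_support, hv, R'.start_mem_support, Or.inl ⟨hv, rfl, rfl⟩⟩

/-- The set `{h} ∪ supp R` for a walk `R` from `a` and a vertex `h` adjacent to `a` is `H`-connected from `a` in walk form. [folklore] -/
theorem walks_hub_support {H : SimpleGraph (Fin n)} {h a t : Fin n} (hha : H.Adj h a) (R : H.Walk a t) :
    ∀ s ∈ ({x | x = h ∨ x ∈ R.support} : Set (Fin n)), ∃ W : H.Walk a s, ∀ v ∈ W.support,
      v ∈ ({x | x = h ∨ x ∈ R.support} : Set (Fin n)) := by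
  rintro s (rfl | hs)
  · refine ⟨SimpleGraph.Walk.cons hha.symm SimpleGraph.Walk.nil, fun v hv => ?_⟩
    rw [SimpleGraph.Walk.support_cons, SimpleGraph.Walk.support_nil, List.mem_cons, List.mem_singleton] at hv
    rcases hv with rfl | rfl
    · exact Or.inr R.start_mem_support
    · exact Or.inl rfl
  · exact ⟨R.takeUntil s hs, fun v hv => Or.inr (R.support_takeUntil_subset_support hs hv)⟩

section Endgame

variable {H G₀ : SimpleGraph (Fin n)} {Hp : Set (Fin n) → SimpleGraph (Fin n)} {C : Fin n → SimpleGraph (Fin n)} {a : Fin n}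
  (hpos : ∀ u v, ¬ hub u → ¬ hub v → pos u = pos v → u = v)
  (hI : ∀ u v, hub u → hub v → ¬ H.Adj u v)
  (g1 : ∀ u v, H.Adj u v → ¬ hub u → ¬ hub v → G₀.Adj u v)
  (g2 : ∀ S u v, H.Adj u v → ¬ hub u → ¬ hub v → (Hp S).Adj u v)
  (g3 : ∀ (S : Set (Fin n)) x u v, hub x → x ∈ S → u ≠ v → ¬ hub u → ¬ hub v → H.Adj x u → H.Adj x v → (Hp S).Adj u v)
  (c1 : ∀ x u v, hub x → u ≠ v → ¬ hub u → ¬ hub v → H.Adj x u → H.Adj x v → (C x).Adj u v)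
  (x0 : ∀ (S : Set (Fin n)) p q r s, (Hp S).Adj p q → G₀.Adj r s → (pos p - pos a).val < (pos r - pos a).val →
    (pos r - pos a).val < (pos q - pos a).val → (pos q - pos a).val < (pos s - pos a).val → False)
  (x0' : ∀ (S : Set (Fin n)) p q r s, G₀.Adj p q → (Hp S).Adj r s → (pos p - pos a).val < (pos r - pos a).val →
    (pos r - pos a).val < (pos q - pos a).val → (pos q - pos a).val < (pos s - pos a).val → False)
  (xC : ∀ (S : Set (Fin n)) x p q r s, hub x → x ∉ S → (Hp S).Adj p q → (C x).Adj r s →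
    (pos p - pos a).val < (pos r - pos a).val → (pos r - pos a).val < (pos q - pos a).val →
    (pos q - pos a).val < (pos s - pos a).val → False)
  (xC' : ∀ (S : Set (Fin n)) x p q r s, hub x → x ∉ S → (C x).Adj p q → (Hp S).Adj r s →
    (pos p - pos a).val < (pos r - pos a).val → (pos r - pos a).val < (pos q - pos a).val →
    (pos q - pos a).val < (pos s - pos a).val → False)
  (xCC : ∀ x x' p q r s, hub x → hub x' → x ≠ x' → (C x).Adj p q → (C x').Adj r s →
    (pos p - pos a).val < (pos r - pos a).val → (pos r - pos a).val < (pos q - pos a).val →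
    (pos q - pos a).val < (pos s - pos a).val → False)
  (ha : ¬ hub a)
include hpos hI g1 g2 g3 c1 x0 x0' xC xC' xCC ha

omit xCC in
/-- GAP FACTS OF A BAD ROOT (cut open at the clash vertex `a`): for a vertex `h ~ a`, a walk `R : a → t` and a walk `R'` avoiding `h` and
`supp R`, no rim vertex of `R` lies strictly between two rim vertices of `R'`. [folklore: Jordan curve] -/
theorem gap_of_root {h t p q : Fin n} (hha : H.Adj h a) (R : H.Walk a t) (R' : H.Walk p q)
    (hR' : ∀ x ∈ R'.support, x ≠ h) (hd : ∀ x, x ∈ R.support → x ∉ R'.support)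
    {s u v : Fin n} (hs : ¬ hub s) (hsR : s ∈ R.support) (hu : ¬ hub u) (huR : u ∈ R'.support) (hv : ¬ hub v)
    (hvR : v ∈ R'.support) :
    ¬ ((pos u - pos a).val < (pos s - pos a).val ∧ (pos s - pos a).val < (pos v - pos a).val) ∧
      ¬ ((pos v - pos a).val < (pos s - pos a).val ∧ (pos s - pos a).val < (pos u - pos a).val) := by
  have hS := walks_hub_support hha R
  have f := cnt_eq_of_walk hpos hI g1 g2 g3 c1 x0 x0' xC xC' ha hS
    (S' := {x | x ∈ ({x | x = h ∨ x ∈ R.support} : Set (Fin n)) ∧ ¬ hub x}) (fun _ => Iff.rfl) R'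
    (fun v hv hvS => by
      rcases hvS with hvh | hvR
      · exact hR' v hv hvh
      · exact hd v hvR hv) u huR v hvR hu hv
  exact NonCrossing.not_between_of_cnt_eq_pos' a _ f ⟨Or.inr hsR, hs⟩

omit hI g1 g2 g3 x0 x0' xC xC' in
/-- CORE OF THE SEPARATION LEMMA (orientation `z < y' < z'`, cut open at `a`).  Bad root data at the apex `h` with clash vertices
`a, z, y', z' ∈ N(h)` (walks `R₁ : a → z`, `R₂ : y' → z'` disjoint and `R₃ : y' → z`, `R₄ : a → z'` disjoint, all avoiding `h`;
representatives `tb₁ ∈ R₁`, `tb₃ ∈ R₃` of the terminal `b` and `tc₂ ∈ R₂`, `tc₄ ∈ R₄` of `c`), together with the four gap facts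
`tb₁ ∉ (y', z')`, `z ∉ (tc₂, y')`, `z' ∉ (tb₃, z)`, `tc₄ ∉ (y', z)`, give representatives `t` of `b` in `(a, y')` and `t'` of `c`
beyond `y'`. [folklore: Jordan curve] -/
theorem sep_core {h z y' z' b c tb₁ tb₃ tc₂ tc₄ : Fin n} (hh : hub h) (hah : H.Adj h a) (hz : H.Adj h z) (hy' : H.Adj h y')
    (hz' : H.Adj h z') (hzr : ¬ hub z) (hy'r : ¬ hub y') (hz'r : ¬ hub z')
    (haz : a ≠ z) (hay' : a ≠ y') (haz' : a ≠ z') (hzz' : z ≠ z') (hbh : b ≠ h) (hch : c ≠ h)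
    (htb₁ : ¬ hub tb₁) (htb₃ : ¬ hub tb₃) (htc₂ : ¬ hub tc₂) (htc₄ : ¬ hub tc₄)
    (hb : (¬ hub b ∧ tb₁ = b ∧ tb₃ = b) ∨ (hub b ∧ H.Adj b tb₁ ∧ H.Adj b tb₃))
    (hc : (¬ hub c ∧ tc₂ = c ∧ tc₄ = c) ∨ (hub c ∧ H.Adj c tc₂ ∧ H.Adj c tc₄))
    (d1y : tb₁ ≠ y') (d1z' : tb₁ ≠ z') (d3a : tb₃ ≠ a) (d3z' : tb₃ ≠ z') (d2a : tc₂ ≠ a) (d2z : tc₂ ≠ z)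
    (d4y : tc₄ ≠ y') (d4z : tc₄ ≠ z)
    (f2 : ¬ ((pos y' - pos a).val < (pos tb₁ - pos a).val ∧ (pos tb₁ - pos a).val < (pos z' - pos a).val) ∧
      ¬ ((pos z' - pos a).val < (pos tb₁ - pos a).val ∧ (pos tb₁ - pos a).val < (pos y' - pos a).val))
    (f3 : ¬ ((pos tc₂ - pos a).val < (pos z - pos a).val ∧ (pos z - pos a).val < (pos y' - pos a).val) ∧
      ¬ ((pos y' - pos a).val < (pos z - pos a).val ∧ (pos z - pos a).val < (pos tc₂ - pos a).val))
    (g2 : ¬ ((pos tb₃ - pos a).val < (pos z' - pos a).val ∧ (pos z' - pos a).val < (pos z - pos a).val) ∧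
      ¬ ((pos z - pos a).val < (pos z' - pos a).val ∧ (pos z' - pos a).val < (pos tb₃ - pos a).val))
    (g4 : ¬ ((pos y' - pos a).val < (pos tc₄ - pos a).val ∧ (pos tc₄ - pos a).val < (pos z - pos a).val) ∧
      ¬ ((pos z - pos a).val < (pos tc₄ - pos a).val ∧ (pos tc₄ - pos a).val < (pos y' - pos a).val))
    (hO : (pos z - pos a).val < (pos y' - pos a).val ∧ (pos y' - pos a).val < (pos z' - pos a).val) :
    ∃ t t', ((¬ hub b ∧ t = b) ∨ (hub b ∧ H.Adj b t)) ∧ ((¬ hub c ∧ t' = c) ∨ (hub c ∧ H.Adj c t')) ∧ ¬ hub t ∧ ¬ hub t' ∧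
      0 < (pos t - pos a).val ∧ (pos t - pos a).val < (pos y' - pos a).val ∧
      (pos y' - pos a).val < (pos t' - pos a).val := by
  have P : ∀ u v : Fin n, ¬ hub u → ¬ hub v → u ≠ v → (pos u - pos a).val ≠ (pos v - pos a).val :=
    fun u v hu hv huv e => huv (hpos u v hu hv (NonCrossing.rot_injective (pos a) e))
  have h0 : (pos a - pos a).val = 0 := NonCrossing.rot_self (pos a)
  have p1y := P tb₁ y' htb₁ hy'r d1y
  have p1z' := P tb₁ z' htb₁ hz'r d1z'
  have p3a := P tb₃ a htb₃ ha d3a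
  have p3z' := P tb₃ z' htb₃ hz'r d3z'
  have p2a := P tc₂ a htc₂ ha d2a
  have p2z := P tc₂ z htc₂ hzr d2z
  have p4y := P tc₄ y' htc₄ hy'r d4y
  have p4z := P tc₄ z htc₄ hzr d4z
  have pza := P z a hzr ha haz.symm
  -- chords of `h`
  have Caz' : (C h).Adj a z' := c1 h a z' hh haz' ha hz'r hah hz'
  have Cay' : (C h).Adj a y' := c1 h a y' hh hay' ha hy'r hah hy'
  have Cy'z' : (C h).Adj y' z' := c1 h y' z' hh (fun e => by rw [e] at hO; omega) hy'r hz'r hy' hz'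
  have Czy' : (C h).Adj z y' := c1 h z y' hh (fun e => by rw [e] at hO; omega) hzr hy'r hz hy'
  have Czz' : (C h).Adj z z' := c1 h z z' hh hzz' hzr hz'r hz hz'
  -- (a) tb₃ < z'
  have a1 : (pos tb₃ - pos a).val < (pos z' - pos a).val := by omega
  -- (b)+(c) tb₁ < y'
  have b1 : (pos tb₁ - pos a).val < (pos y' - pos a).val := by
    by_contra hge
    have hgt : (pos z' - pos a).val < (pos tb₁ - pos a).val := by omega
    rcases hb with ⟨-, e1, e3⟩ | ⟨hbh', hb1, hb3⟩
    · rw [e1] at hgt; rw [e3] at a1; omega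
    · have hne : tb₃ ≠ tb₁ := fun e => by rw [e] at a1; omega
      exact xCC h b a z' tb₃ tb₁ hh hbh' (Ne.symm hbh) Caz' (c1 b tb₃ tb₁ hbh' hne htb₃ htb₁ hb3 hb1) (by omega) a1 hgt
  -- (d) tb₃ ≤ y'
  have dd : ¬ (pos y' - pos a).val < (pos tb₃ - pos a).val := by
    intro hlt
    rcases hb with ⟨-, e1, e3⟩ | ⟨hbh', hb1, hb3⟩
    · rw [e1] at b1; rw [e3] at hlt; omega
    · have hne : tb₁ ≠ tb₃ := fun e => by rw [e] at b1; omega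
      exact xCC b h tb₁ tb₃ y' z' hbh' hh hbh (c1 b tb₁ tb₃ hbh' hne htb₁ htb₃ hb1 hb3) Cy'z' b1 hlt a1
  -- (e) the representative of `b`
  obtain ⟨t, htrep, htrim, ht0, htY⟩ : ∃ t, ((¬ hub b ∧ t = b) ∨ (hub b ∧ H.Adj b t)) ∧ ¬ hub t ∧
      0 < (pos t - pos a).val ∧ (pos t - pos a).val < (pos y' - pos a).val := by
    by_cases e : tb₃ = y'
    · rcases hb with ⟨-, e1, e3⟩ | ⟨hbh', hb1, hb3⟩
      · exfalso; exact d1y (e1.trans (e3.symm.trans e))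
      · refine ⟨tb₁, Or.inr ⟨hbh', hb1⟩, htb₁, ?_, b1⟩
        rcases Nat.eq_zero_or_pos ((pos tb₁ - pos a).val) with h0' | hp
        · exfalso
          have e' : tb₁ = a := hpos tb₁ a htb₁ ha (NonCrossing.rot_injective (pos a) (h0'.trans h0.symm))
          exact xCC b h a y' z z' hbh' hh hbh (c1 b a y' hbh' hay' ha hy'r (e' ▸ hb1) (e ▸ hb3)) Czz' (by omega) hO.1 hO.2
        · exact hp
    · refine ⟨tb₃, ?_, htb₃, by omega, ?_⟩
      · rcases hb with ⟨hbr, -, e3⟩ | ⟨hbh', -, hb3⟩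
        · exact Or.inl ⟨hbr, e3⟩
        · exact Or.inr ⟨hbh', hb3⟩
      · have := P tb₃ y' htb₃ hy'r e; omega
  -- (f) tc₂ > z and (h) tc₂ ≥ y'
  have f1 : (pos z - pos a).val < (pos tc₂ - pos a).val := by omega
  have hh1 : ¬ (pos tc₂ - pos a).val < (pos y' - pos a).val := by
    intro hlt
    rcases hc with ⟨-, e2, e4⟩ | ⟨hch', hc2, hc4⟩
    · rw [e2] at hlt f1; rw [e4] at g4; omega
    · have hne : tc₄ ≠ tc₂ := fun e => by rw [e] at g4; omega
      rcases (show (pos tc₄ - pos a).val < (pos z - pos a).val ∨ (pos y' - pos a).val < (pos tc₄ - pos a).val by omega)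
        with l | l
      · exact xCC c h tc₄ tc₂ z y' hch' hh hch (c1 c tc₄ tc₂ hch' hne htc₄ htc₂ hc4 hc2) Czy' l f1 hlt
      · exact xCC h c z y' tc₂ tc₄ hh hch' (Ne.symm hch) Czy' (c1 c tc₂ tc₄ hch' (Ne.symm hne) htc₂ htc₄ hc2 hc4) f1 hlt l
  -- (i) the representative of `c`
  obtain ⟨t', ht'rep, ht'rim, ht'Y⟩ : ∃ t', ((¬ hub c ∧ t' = c) ∨ (hub c ∧ H.Adj c t')) ∧ ¬ hub t' ∧
      (pos y' - pos a).val < (pos t' - pos a).val := by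
    by_cases e : tc₂ = y'
    · rcases hc with ⟨-, e2, e4⟩ | ⟨hch', hc2, hc4⟩
      · exfalso; exact d4y (e4.trans (e2.symm.trans e))
      · refine ⟨tc₄, Or.inr ⟨hch', hc4⟩, htc₄, ?_⟩
        by_contra hle
        have l : (pos tc₄ - pos a).val < (pos z - pos a).val := by omega
        exact xCC c h tc₄ y' z z' hch' hh hch (c1 c tc₄ y' hch' d4y htc₄ hy'r hc4 (e ▸ hc2)) Czz' l hO.1 hO.2
    · refine ⟨tc₂, ?_, htc₂, ?_⟩
      · rcases hc with ⟨hcr, e2, -⟩ | ⟨hch', hc2, -⟩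
        · exact Or.inl ⟨hcr, e2⟩
        · exact Or.inr ⟨hch', hc2⟩
      · have := P tc₂ y' htc₂ hy'r e; omega
  exact ⟨t, t', htrep, ht'rep, htrim, ht'rim, ht0, htY, ht'Y⟩

/-- **A BAD APEX ROOT SEPARATES ITS TERMINALS** (cut open at the clash vertex `a`).  Bad root data at the apex `h` (clash vertices
`a, z, y', z' ∈ N(h)`; walks `R₁ : a → z`, `R₂ : y' → z'` with disjoint supports and `R₃ : y' → z`, `R₄ : a → z'` with disjoint
supports, all avoiding `h`; representatives `tb₁ ∈ supp R₁`, `tb₃ ∈ supp R₃` of the terminal `b` and `tc₂ ∈ supp R₂`, `tc₄ ∈ supp R₄`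
of `c` — a rim terminal represents itself, an apex terminal is adjacent to its representatives) yield representatives `t` of `b` and
`t'` of `c` strictly separated by the chord `{a, y'}` of `h`: the sector condition at `(h; b, c)` fails. [folklore: Jordan curve] -/
theorem sep_of_badRoot {h z y' z' b c tb₁ tb₃ tc₂ tc₄ : Fin n} (hh : hub h) (hah : H.Adj h a) (hz : H.Adj h z) (hy' : H.Adj h y')
    (hz' : H.Adj h z') (hzr : ¬ hub z) (hy'r : ¬ hub y') (hz'r : ¬ hub z')
    (haz : a ≠ z) (hay' : a ≠ y') (haz' : a ≠ z') (hzy' : z ≠ y') (hzz' : z ≠ z') (hy'z' : y' ≠ z')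
    (hbh : b ≠ h) (hch : c ≠ h)
    (R₁ : H.Walk a z) (R₂ : H.Walk y' z') (R₃ : H.Walk y' z) (R₄ : H.Walk a z')
    (hR₁ : ∀ x ∈ R₁.support, x ≠ h) (hR₂ : ∀ x ∈ R₂.support, x ≠ h) (hR₃ : ∀ x ∈ R₃.support, x ≠ h)
    (hR₄ : ∀ x ∈ R₄.support, x ≠ h)
    (hd₁₂ : ∀ x, x ∈ R₁.support → x ∉ R₂.support) (hd₃₄ : ∀ x, x ∈ R₃.support → x ∉ R₄.support)
    (htb₁ : ¬ hub tb₁) (htb₁R : tb₁ ∈ R₁.support) (htb₃ : ¬ hub tb₃) (htb₃R : tb₃ ∈ R₃.support)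
    (hb : (¬ hub b ∧ tb₁ = b ∧ tb₃ = b) ∨ (hub b ∧ H.Adj b tb₁ ∧ H.Adj b tb₃))
    (htc₂ : ¬ hub tc₂) (htc₂R : tc₂ ∈ R₂.support) (htc₄ : ¬ hub tc₄) (htc₄R : tc₄ ∈ R₄.support)
    (hc : (¬ hub c ∧ tc₂ = c ∧ tc₄ = c) ∨ (hub c ∧ H.Adj c tc₂ ∧ H.Adj c tc₄)) :
    ∃ t t', ((¬ hub b ∧ t = b) ∨ (hub b ∧ H.Adj b t)) ∧ ((¬ hub c ∧ t' = c) ∨ (hub c ∧ H.Adj c t')) ∧ ¬ hub t ∧ ¬ hub t' ∧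
      ((0 < (pos t - pos a).val ∧ (pos t - pos a).val < (pos y' - pos a).val ∧
          (pos y' - pos a).val < (pos t' - pos a).val) ∨
        (0 < (pos t' - pos a).val ∧ (pos t' - pos a).val < (pos y' - pos a).val ∧
          (pos y' - pos a).val < (pos t - pos a).val)) := by
  have P : ∀ u v : Fin n, ¬ hub u → ¬ hub v → u ≠ v → (pos u - pos a).val ≠ (pos v - pos a).val :=
    fun u v hu hv huv e => huv (hpos u v hu hv (NonCrossing.rot_injective (pos a) e))
  have hy'R₂ : y' ∈ R₂.support := R₂.start_mem_support
  have hz'R₂ : z' ∈ R₂.support := R₂.end_mem_support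
  have hzR₁ : z ∈ R₁.support := R₁.end_mem_support
  have haR₁ : a ∈ R₁.support := R₁.start_mem_support
  have hy'R₃ : y' ∈ R₃.support := R₃.start_mem_support
  have hzR₃ : z ∈ R₃.support := R₃.end_mem_support
  have haR₄ : a ∈ R₄.support := R₄.start_mem_support
  have hz'R₄ : z' ∈ R₄.support := R₄.end_mem_support
  have hd₄₃ : ∀ x, x ∈ R₄.support → x ∉ R₃.support := fun x h4 h3 => hd₃₄ x h3 h4
  -- gap facts: `{h} ∪ supp R₁` against `R₂`, `{h} ∪ supp R₄` against `R₃` (and the mirror pair)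
  have Y1 := fun {s u v : Fin n} (hs : ¬ hub s) (hsR : s ∈ R₁.support) (hu : ¬ hub u) (huR : u ∈ R₂.support) (hv : ¬ hub v)
    (hvR : v ∈ R₂.support) => gap_of_root hpos hI g1 g2 g3 c1 x0 x0' xC xC' ha hah R₁ R₂ hR₂ hd₁₂ hs hsR hu huR hv hvR
  have Y2 := fun {s u v : Fin n} (hs : ¬ hub s) (hsR : s ∈ R₄.support) (hu : ¬ hub u) (huR : u ∈ R₃.support) (hv : ¬ hub v)
    (hvR : v ∈ R₃.support) => gap_of_root hpos hI g1 g2 g3 c1 x0 x0' xC xC' ha hah R₄ R₃ hR₃ hd₄₃ hs hsR hu huR hv hvR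
  have o1 := Y1 hzr hzR₁ hy'r hy'R₂ hz'r hz'R₂
  have o2 := Y2 hz'r hz'R₄ hy'r hy'R₃ hzr hzR₃
  have dzy' := P z y' hzr hy'r hzy'
  have dzz' := P z z' hzr hz'r hzz'
  have dy'z' := P y' z' hy'r hz'r hy'z'
  rcases (show ((pos z - pos a).val < (pos y' - pos a).val ∧ (pos y' - pos a).val < (pos z' - pos a).val) ∨
      ((pos z' - pos a).val < (pos y' - pos a).val ∧ (pos y' - pos a).val < (pos z - pos a).val) by omega) with hO | hO
  · obtain ⟨t, t', h1, h2, h3, h4, h5, h6, h7⟩ := sep_core hpos c1 xCC ha hh hah hz hy' hz' hzr hy'r hz'r haz hay' haz' hzz'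
      hbh hch htb₁ htb₃ htc₂ htc₄ hb hc (fun e => hd₁₂ _ htb₁R (e ▸ hy'R₂)) (fun e => hd₁₂ _ htb₁R (e ▸ hz'R₂))
      (fun e => hd₃₄ _ htb₃R (e ▸ haR₄)) (fun e => hd₃₄ _ htb₃R (e ▸ hz'R₄)) (fun e => hd₁₂ _ haR₁ (e ▸ htc₂R))
      (fun e => hd₁₂ _ hzR₁ (e ▸ htc₂R)) (fun e => hd₃₄ _ hy'R₃ (e ▸ htc₄R)) (fun e => hd₃₄ _ hzR₃ (e ▸ htc₄R))
      (Y1 htb₁ htb₁R hy'r hy'R₂ hz'r hz'R₂) (Y1 hzr hzR₁ htc₂ htc₂R hy'r hy'R₂) (Y2 hz'r hz'R₄ htb₃ htb₃R hzr hzR₃)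
      (Y2 htc₄ htc₄R hy'r hy'R₃ hzr hzR₃) hO
    exact ⟨t, t', h1, h2, h3, h4, Or.inl ⟨h5, h6, h7⟩⟩
  · -- the mirror: `z ↔ z'`, `b ↔ c`, `R₁ ↔ R₄`, `R₂ ↔ R₃`
    have hb' : (¬ hub b ∧ tb₃ = b ∧ tb₁ = b) ∨ (hub b ∧ H.Adj b tb₃ ∧ H.Adj b tb₁) := by
      rcases hb with ⟨h1, h2, h3⟩ | ⟨h1, h2, h3⟩
      · exact Or.inl ⟨h1, h3, h2⟩
      · exact Or.inr ⟨h1, h3, h2⟩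
    have hc' : (¬ hub c ∧ tc₄ = c ∧ tc₂ = c) ∨ (hub c ∧ H.Adj c tc₄ ∧ H.Adj c tc₂) := by
      rcases hc with ⟨h1, h2, h3⟩ | ⟨h1, h2, h3⟩
      · exact Or.inl ⟨h1, h3, h2⟩
      · exact Or.inr ⟨h1, h3, h2⟩
    obtain ⟨t, t', h1, h2, h3, h4, h5, h6, h7⟩ := sep_core hpos c1 xCC ha hh hah hz' hy' hz hz'r hy'r hzr haz' hay' haz
      hzz'.symm hch hbh htc₄ htc₂ htb₃ htb₁ hc' hb' (fun e => hd₃₄ _ hy'R₃ (e ▸ htc₄R)) (fun e => hd₃₄ _ hzR₃ (e ▸ htc₄R))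
      (fun e => hd₁₂ _ haR₁ (e ▸ htc₂R)) (fun e => hd₁₂ _ hzR₁ (e ▸ htc₂R)) (fun e => hd₃₄ _ htb₃R (e ▸ haR₄))
      (fun e => hd₃₄ _ htb₃R (e ▸ hz'R₄)) (fun e => hd₁₂ _ htb₁R (e ▸ hy'R₂)) (fun e => hd₁₂ _ htb₁R (e ▸ hz'R₂))
      (Y2 htc₄ htc₄R hy'r hy'R₃ hzr hzR₃) (Y2 hz'r hz'R₄ htb₃ htb₃R hy'r hy'R₃) (Y1 hzr hzR₁ htc₂ htc₂R hz'r hz'R₂)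
      (Y1 htb₁ htb₁R hy'r hy'R₂ hz'r hz'R₂) hO
    exact ⟨t', t, h2, h1, h4, h3, Or.inr ⟨h5, h6, h7⟩⟩

end Endgame

end Apices

end Consts

end Summit.CriticalPhenomena.PercolationContinuityZ3.Theorems
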